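import Summits.QuantumFields.YangMills.Theorems.BalabanUVNodesK0Stub1BHolds
import Summits.QuantumFields.YangMills.Theses.BalabanUVNodes
import Summits.QuantumFields.YangMills.Theorems.BalabanUVNodesK0AllTorusOfStepTokensGuardedZBLamPrintAx

/-!
# K0ᴬ (stmt-QuantumFields-27238 `Record13SepCoPHInhabitedAx`) — `…K0V23Stub3Sockets` RE-CENTRED (OP 5a ∕ H3.3, the Ax EDITION): the re-centred stub-3ᴬ′ᴮ text
# `K0V23DefsAx.AbsBetaBoxAtThm1WitnessCCMGenGridGZBAxAt F` ⟺ its UNIFORM CORE; the TOKEN-FREE core of the print-regime member of `theta13OfThm1CCMWZBAx` pays it; the LOCATED-K0ε₀ text by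
# relabelling; and K0ᴬ `Record13SepCoPHInhabitedAx` BY NAME from stub 1ᴮ (PROVED), the stub-2′ text, the seam and the text ∕ the core

Cell `pub-ymgap` (YM-PLAN Track A, D-0062), width seat `pub-ymgap-dag-n07-w3` (g22; dag-lead g40 HANDS-3 H3.3 «Ax∕χ editions of DEF-1's trio `K0V23Stub3{DoorSuppliers,Sockets,ComparabilitySuppliers}` …
new basenames, `--supports stmt-QuantumFields-27238 --as helper`»).  COUNT-NEUTRAL; theorems only — 0 `def` ∕ `sorry` ∕ `instance` ∕ `notation`; NEW additive leaf — DEF-1 g29's `…K0V23Stub3Sockets`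
(key 20541, K0⁷ aside) stays landed and true on its own text.  [I] = [Balaban1987RG1]; [15] = [Balaban1985Variational]; [6] = [Balaban1985RegularSpaces]; [III] = [Balaban1988Convergent].

WHAT THIS FILE IS.  The σ-IMAGE of `…K0V23Stub3Sockets` (289 l.) under director-ym №467 (D)'s re-centring: σ = { `theta13OfThm1CCMWZB ↦ theta13OfThm1CCMWZBAx` (def-Y (c), same arity),
`betaOfRecord₁₃ ↦ betaOfRecord₁₃Ax`, `gOfRecord₁₃ ↦ gOfRecord₁₃Ax`, `UbgOfRecord₁₃CoP θ ↦ UbgOfRecord₁₃CoPChi θ (chiβOfRecord₁₃Ax θ)`, `Provisos₁₃SepCoPH ∕ SlotsNondegenerate₁₃ ↦ …Ax`, V23 texts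
`K0V23Defs.AbsBetaBox…GZB{,Eps0}At ↦ K0V23DefsAx.…GZB{,Eps0}AxAt` (p803783; stub 1ᴮ `Prop8StepCoPGridGBAt` and the letter `K0N09Eps0LetterAt` are CENTRE-BLIND, verbatim), doors
`K0V23Defs.k0Body_of_stub1B_of_2P_of_{3B,eps0B} ↦ K0AllTorusOfStepTokensGuardedZBLamAx.k0BodyAx_of_stub1B_of_2P_of_{3B,eps0B}`, crux decl `Record13SepCoPHInhabited ↦ Record13SepCoPHInhabitedAx` }.
Every proof is the source's proof term under σ (the letter census stays `rfl`: the block-axial β reads the witness through `toStage8Params`, `ν.εreg = a₀` and `ε₂₉` only).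
* §1 `betaOfRecord₁₃_zbRegime_letterBlind` (`rfl` census at Ax), `absBoxZBRegime_iff_letters`.  §2 ★ `absBetaBoxGZBAt_iff_uniformZB`.  §3 ★ `tokenFreeZB_of_boxAtOneMember`,
  `absBetaBoxGZBAt_of_tokenFreeZB`, `absBetaBoxGZBEps0At_of_tokenFreeZB`.  §4 `absBetaBoxGZBEps0At_of_GZBAt` ∕ `_iff_` ∕ `forall_…`, `exists_window_absBoxZB_of_GZBAt`, `forall_label_absBoxZB_of_GZBAt`.
* §5 ★★ `k0Body_of_absBetaBoxGZB_byName`, ★★★ `k0Body_of_tokenFreeZB_byName`, ★★ `record13SepCoPHInhabitedAx_of_absBetaBoxGZB_byName`, ★★★ `record13SepCoPHInhabitedAx_of_tokenFreeZB_byName` —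
  `Summit.QuantumFields.YangMills.Theses.BalabanUVNodes.Record13SepCoPHInhabitedAx` BY NAME from stub 1ᴮ PROVED (`K0Stub1BHolds.prop8StepCoPGridGBAt_holds_all`), the stub-2′ text, the
  displayed seam `hseam` (post-seam `K0AllTorusOfStepTokensGuardedZBLamAx.hseamAx_rfl`) and the re-centred text ∕ the token-free core.
HONEST FRAMING (binding).  Currency bookkeeping over accepted tree names; every ★ theorem is CONDITIONAL on its displayed hypotheses; the TOKEN-FREE CORE (one sign-free |β| box per radius at
the re-centred print-regime member) is NOT proved here or anywhere in the tree — it is NODE O's wall ([I] Thm 1 p.259 with the Thm 2∕3 remainder estimates); nothing of Bałaban asserted or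
discharged; K0ᴬ 27238 ∕ K1ᴬ 27239 ∕ K3ᴬ 27247 OPEN; N07 ∕ N09 NOT discharged; COUNT 8∕28 · K 1∕4 UNMOVED; R4 = the CONDITIONAL finite-𝕋⁴ rung `BalabanLadder.UV` only — NOT continuum ∕ ℝ⁴ ∕ OS;
**the Yang–Mills mass gap (Clay) is NOT proved by any of this.**
-/

noncomputable section

open scoped Matrix.Norms.L2Operator

namespace Summit.QuantumFields.YangMills.Theorems.K0V23Stub3SocketsAx

open Literature.MathematicalPhysics.QuantumFieldTheory.Balaban1983to89
open Literature.MathematicalPhysics.QuantumFieldTheory.Balaban1983to89.Node00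
open Literature.MathematicalPhysics.QuantumFieldTheory.Balaban1983to89.T4Continuum
open Literature.MathematicalPhysics.QuantumFieldTheory.Balaban1983to89.FlowStep
open Literature.MathematicalPhysics.QuantumFieldTheory.Balaban1983to89.B15DeterminingSets
open Literature.MathematicalPhysics.QuantumFieldTheory.Balaban1983to89.B8LeafModelZd (ZdIdx)
open Summit.QuantumFields.YangMills.Theorems.K0V23Defs (Prop8StepCoPGridGBAt K0N09Eps0LetterAt)
open Summit.QuantumFields.YangMills.Theorems.K0V23DefsAx (AbsBetaBoxAtThm1WitnessCCMGenGridGZBAxAt AbsBetaBoxAtThm1WitnessCCMGenGridGZBEps0AxAt absBetaBoxGenGridGZBAxAt_of_eps0)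
open Summit.QuantumFields.YangMills.Theorems.K0AllTorusOfStepTokensGuardedZBLamAx (k0BodyAx_of_stub1B_of_2P_of_3B k0BodyAx_of_stub1B_of_2P_of_eps0B)
open Summit.QuantumFields.YangMills.BalabanUVNodes.K0Stub1BHolds (prop8StepCoPGridGBAt_holds_all)

/-! ## §1  The letter census at the print-regime Z3 member (`rfl`) and the box transport -/

section Census

variable (F : T4Family) (j j' : ℕ) (a₀ ε₀ ε₀' ε₂₉ B₃ C₃ B₃' C₃' a₁ c₁ γ₀ β' : ℝ) (Efl logz Efl' logz' : B12.RunParams → ℕ → ℝ)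

/-- **★ LETTER CENSUS AT THE PRINT-REGIME Z3 MEMBER (`rfl`)**: at `θ₁₃ᶜᶜᴹᵂᶻᴮ(j; ½; εbg := a₀; ε₀, ε₂₉; B₃, B₃′, a₀, a₁; Efl, logz)` the β-functions of record ([I] (1.20)–(1.22) on the
merged term (1.6), window `½`, background radius `εbg = a₀`, β-slot χ = the (2.9) species at `(ν.εreg = a₀, ε₂₉)`) do NOT read the cube letter `j`, the (1.2) letter `ε₀`, the (8)∕(9)
constants `B₃, B₃′, a₁`, nor the normalisation letters `Efl, logz`: all those members have THE SAME β, a function of `(F; a₀, ε₂₉)` alone. [cite: Balaban1987RG1, (1.20)–(1.22) p.264, (1.6) p.261, (0.21) p.256, (2.9) p.266, (1.2) p.260; Balaban1985Variational, Thm 1 (8),(9) p.279 (bookkeeping)] -/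
theorem betaOfRecord₁₃_zbRegime_letterBlind :
    betaOfRecord₁₃Ax F 2 (theta13OfThm1CCMWZBAx F 2 j (1 / 2) a₀ ε₀ ε₂₉ B₃ B₃' a₀ a₁ Efl logz) =
      betaOfRecord₁₃Ax F 2 (theta13OfThm1CCMWZBAx F 2 j' (1 / 2) a₀ ε₀' ε₂₉ C₃ C₃' a₀ c₁ Efl' logz') := rfl

/-- **The abs β-box of any two print-regime Z3 members with the same `(a₀, ε₂₉)` is THE SAME PROPOSITION** (one `rw` by the census). [cite: Balaban1987RG1, Thm 1 p.259, (1.20)–(1.22) p.264, (1.2) p.260 (bookkeeping)] -/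
theorem absBoxZBRegime_iff_letters :
    (BetaLowerH (-β') γ₀ (betaOfRecord₁₃Ax F 2 (theta13OfThm1CCMWZBAx F 2 j (1 / 2) a₀ ε₀ ε₂₉ B₃ B₃' a₀ a₁ Efl logz)) ∧
      BetaUpperH β' γ₀ (betaOfRecord₁₃Ax F 2 (theta13OfThm1CCMWZBAx F 2 j (1 / 2) a₀ ε₀ ε₂₉ B₃ B₃' a₀ a₁ Efl logz))) ↔
    (BetaLowerH (-β') γ₀ (betaOfRecord₁₃Ax F 2 (theta13OfThm1CCMWZBAx F 2 j' (1 / 2) a₀ ε₀' ε₂₉ C₃ C₃' a₀ c₁ Efl' logz')) ∧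
      BetaUpperH β' γ₀ (betaOfRecord₁₃Ax F 2 (theta13OfThm1CCMWZBAx F 2 j' (1 / 2) a₀ ε₀' ε₂₉ C₃ C₃' a₀ c₁ Efl' logz'))) := by
  rw [betaOfRecord₁₃_zbRegime_letterBlind F j j' a₀ ε₀ ε₀' ε₂₉ B₃ C₃ B₃' C₃' a₁ c₁ Efl logz Efl' logz']

end Census

/-! ## §2  ★ The V23 stub-3ᴬ′ᴮ text ⟺ its UNIFORM CORE -/

section Uniform

variable (F : T4Family)

/-- **★ THE V23 3ᴬ′ᴮ TEXT ⟺ ITS UNIFORM CORE.**  `K0V23DefsAx.AbsBetaBoxAtThm1WitnessCCMGenGridGZBAxAt F` (binders `(j c c₀ c₁; B₃ B₃′ a₀ a₁)`, riders `c ≤ L^j`, `c₀ ≤ j+1`, `c₁ ≤ j`, both [15]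
antecedents — the ᴮ (8)-sentence `VariationalThm1RegSepCoP7MGB` and the ᴮ (9)-token `Gauge9RegSepTopStepGB` at print's [P2] (2.3) datum under the grid guard `A‴(c, c₀, c₁)` — then ONE abs
β-box of the print-regime Z3 member) holds IFF for every radius `a₀ > 0` AT WHICH THE TWO ANTECEDENTS ARE JOINTLY INHABITED (for some `j, c, c₀, c₁, B₃, B₃′, a₁` with the riders), SOME
`γ₀, ε₂₉ > 0`, `β′` box the ONE family `β₁₃(F; a₀, ε₂₉)` on `]0, γ₀]` at EVERY member `(j, ε₀, B₃, B₃′, a₁, Efl, logz)`.  So the [15] antecedents restrict only the SET OF RADII at which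
the box is owed; they lend nothing to the box itself.  A repackaging (§1); nothing asserted. [cite: Balaban1987RG1, Thm 1 p.259, §1 (1.20)–(1.22) p.264, (2.9) p.266, (0.1) p.251; Balaban1985Variational, Thm 1 (8)–(9) p.279, p.304 lines 1–2; Balaban1984PropagatorsII, (2.3) p.224; Balaban1989LargeFieldII, p.355] -/
theorem absBetaBoxGZBAt_iff_uniformZB :
    AbsBetaBoxAtThm1WitnessCCMGenGridGZBAxAt F ↔
      ∀ a₀ : ℝ, 0 < a₀ →
        (∃ (j c c₀ c₁ : ℕ) (B₃ B₃' a₁ : ℝ), c ≤ F.L ^ j ∧ c₀ ≤ j + 1 ∧ c₁ ≤ j ∧ 2 * (F.L : ℝ) ^ 2 ≤ B₃ ∧ 0 < B₃' ∧ 0 < a₁ ∧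
          VariationalThm1RegSepCoP7MGB F 2
            (fun ν M g K k _s => c ≤ ν.M₁ ∧ k + c₀ ≤ F.m + K ∧ F.L ^ c₁ ∣ M ∧
              ∀ i, 1 ≤ i → i ≤ k → dCubeSide (F.P K).L M (RkOfRecord (F.P K).L ν.r (g i)) i ∣ (F.P K).sitesPerDir 0) (lamDatum F) (dataSmall7LamTopOf F 2) B₃ a₀ a₁ ∧
          Gauge9RegSepTopStepGB F 2 (fun ν K Ω => suppDomOfRecord F ν K Ω) (F.L ^ j)
            (fun ν M g K k _s => c ≤ ν.M₁ ∧ k + c₀ ≤ F.m + K ∧ F.L ^ c₁ ∣ M ∧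
              ∀ i, 1 ≤ i → i ≤ k → dCubeSide (F.P K).L M (RkOfRecord (F.P K).L ν.r (g i)) i ∣ (F.P K).sitesPerDir 0) (lamDatum F) (dataSmall7LamTopOf F 2) B₃ B₃' a₀ a₁) →
        ∃ γ₀ ε₂₉ β' : ℝ, 0 < γ₀ ∧ 0 < ε₂₉ ∧ ∀ (j : ℕ) (ε₀ B₃ B₃' a₁ : ℝ) (Efl logz : B12.RunParams → ℕ → ℝ),
          BetaLowerH (-β') γ₀ (betaOfRecord₁₃Ax F 2 (theta13OfThm1CCMWZBAx F 2 j (1 / 2) a₀ ε₀ ε₂₉ B₃ B₃' a₀ a₁ Efl logz)) ∧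
          BetaUpperH β' γ₀ (betaOfRecord₁₃Ax F 2 (theta13OfThm1CCMWZBAx F 2 j (1 / 2) a₀ ε₀ ε₂₉ B₃ B₃' a₀ a₁ Efl logz)) := by
  constructor
  · rintro h a₀ ha₀ ⟨j, c, c₀, c₁, B₃, B₃', a₁, hc, hc₀, hc₁, hB₃, hB₃', ha₁, h15, h9⟩
    obtain ⟨γ₀, ε₀, ε₂₉, β', hγ₀, -, hε', hlow, hup⟩ := h j c c₀ c₁ B₃ B₃' a₀ a₁ hc hc₀ hc₁ hB₃ hB₃' ha₀ ha₁ h15 h9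
    refine ⟨γ₀, ε₂₉, β', hγ₀, hε', fun j' ε₀' C₃ C₃' c₁' Efl' logz' => ?_⟩
    rw [← betaOfRecord₁₃_zbRegime_letterBlind F j j' a₀ ε₀ ε₀' ε₂₉ B₃ C₃ B₃' C₃' a₁ c₁' (fun _ _ => 0) (fun _ _ => 0) Efl' logz']
    exact ⟨hlow, hup⟩
  · intro h j c c₀ c₁ B₃ B₃' a₀ a₁ hc hc₀ hc₁ hB₃ hB₃' ha₀ ha₁ h15 h9
    obtain ⟨γ₀, ε₂₉, β', hγ₀, hε', hall⟩ := h a₀ ha₀ ⟨j, c, c₀, c₁, B₃, B₃', a₁, hc, hc₀, hc₁, hB₃, hB₃', ha₁, h15, h9⟩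
    exact ⟨γ₀, a₀, ε₂₉, β', hγ₀, ha₀, hε', hall j a₀ B₃ B₃' a₁ (fun _ _ => 0) (fun _ _ => 0)⟩

end Uniform

/-! ## §3  ★ The TOKEN-FREE core of the print-regime Z3 member pays the V23 text and the strengthened text -/

section TokenFree

variable (F : T4Family)

/-- The K0–N09 interface letter at the top of its window: `2·a₀ ≤ a₀·L²` for `0 ≤ a₀` (since `11 < L`).  Bookkeeping. [cite: Balaban1987RG1, (0.1) p.251, (1.2) p.260 (bookkeeping)] -/
private theorem eps0Letter_self {a₀ : ℝ} (ha₀ : 0 ≤ a₀) : K0N09Eps0LetterAt F a₀ a₀ := by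
  have hL : (12 : ℝ) ≤ (F.L : ℝ) := by exact_mod_cast F.hL11
  have hL2 : (2 : ℝ) ≤ (F.L : ℝ) ^ 2 := by nlinarith
  show 2 * a₀ ≤ a₀ * (F.L : ℝ) ^ 2
  nlinarith

/-- **A box at ANY ONE print-regime Z3 member per radius IS the token-free core** (§1): a producer may deliver its box at whatever letters `(j, ε₀, B₃, B₃′, a₁, Efl, logz)` its road
carries. [cite: Balaban1987RG1, Thm 1 p.259, §1 (1.20)–(1.22) p.264, (2.9) p.266 (bookkeeping)] -/
theorem tokenFreeZB_of_boxAtOneMember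
    (h : ∀ a₀ : ℝ, 0 < a₀ → ∃ (γ₀ ε₂₉ β' : ℝ) (j : ℕ) (ε₀ B₃ B₃' a₁ : ℝ) (Efl logz : B12.RunParams → ℕ → ℝ), 0 < γ₀ ∧ 0 < ε₂₉ ∧
      BetaLowerH (-β') γ₀ (betaOfRecord₁₃Ax F 2 (theta13OfThm1CCMWZBAx F 2 j (1 / 2) a₀ ε₀ ε₂₉ B₃ B₃' a₀ a₁ Efl logz)) ∧
      BetaUpperH β' γ₀ (betaOfRecord₁₃Ax F 2 (theta13OfThm1CCMWZBAx F 2 j (1 / 2) a₀ ε₀ ε₂₉ B₃ B₃' a₀ a₁ Efl logz))) :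
    ∀ a₀ : ℝ, 0 < a₀ → ∃ γ₀ ε₂₉ β' : ℝ, 0 < γ₀ ∧ 0 < ε₂₉ ∧ ∀ (j : ℕ) (ε₀ B₃ B₃' a₁ : ℝ),
      BetaLowerH (-β') γ₀ (betaOfRecord₁₃Ax F 2 (theta13OfThm1CCMWZBAx F 2 j (1 / 2) a₀ ε₀ ε₂₉ B₃ B₃' a₀ a₁ (fun _ _ => 0) (fun _ _ => 0))) ∧
      BetaUpperH β' γ₀ (betaOfRecord₁₃Ax F 2 (theta13OfThm1CCMWZBAx F 2 j (1 / 2) a₀ ε₀ ε₂₉ B₃ B₃' a₀ a₁ (fun _ _ => 0) (fun _ _ => 0))) := by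
  intro a₀ ha₀
  obtain ⟨γ₀, ε₂₉, β', j, ε₀, B₃, B₃', a₁, Efl, logz, hγ₀, hε', hlow, hup⟩ := h a₀ ha₀
  refine ⟨γ₀, ε₂₉, β', hγ₀, hε', fun j' ε₀' C₃ C₃' c₁' => ?_⟩
  rw [← betaOfRecord₁₃_zbRegime_letterBlind F j j' a₀ ε₀ ε₀' ε₂₉ B₃ C₃ B₃' C₃' a₁ c₁' Efl logz (fun _ _ => 0) (fun _ _ => 0)]
  exact ⟨hlow, hup⟩

/-- **★ THE TOKEN-FREE CORE PAYS THE V23 3ᴬ′ᴮ TEXT**: ONE sign-free box of the family `β₁₃(F; εbg = εreg = a₀, ε₂₉)` on `]0, γ₀]` for EVERY radius `a₀ > 0` at SOME `γ₀, ε₂₉ > 0`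
(NODE O's bill for K0ᴬ, text-independent) gives `K0V23DefsAx.AbsBetaBoxAtThm1WitnessCCMGenGridGZBAxAt F` — the [15] antecedents are not read.  So a by-name proof of the V23 skeleton's
`stub_absBetaBoxAtThm1WitnessCCMGenGridGZB13` is `fun F => absBetaBoxGZBAt_of_tokenFreeZB F (box F)`.  CONDITIONAL; nothing asserted. [cite: Balaban1987RG1, Thm 1 p.259, §1 (1.20)–(1.22) p.264, (2.9) p.266, (0.1) p.251; Balaban1985Variational, Thm 1 (8)–(9) p.279, p.304 lines 1–2; Balaban1984PropagatorsII, (2.3) p.224; Balaban1989LargeFieldII, p.355] -/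
theorem absBetaBoxGZBAt_of_tokenFreeZB
    (h : ∀ a₀ : ℝ, 0 < a₀ → ∃ γ₀ ε₂₉ β' : ℝ, 0 < γ₀ ∧ 0 < ε₂₉ ∧ ∀ (j : ℕ) (ε₀ B₃ B₃' a₁ : ℝ),
      BetaLowerH (-β') γ₀ (betaOfRecord₁₃Ax F 2 (theta13OfThm1CCMWZBAx F 2 j (1 / 2) a₀ ε₀ ε₂₉ B₃ B₃' a₀ a₁ (fun _ _ => 0) (fun _ _ => 0))) ∧
      BetaUpperH β' γ₀ (betaOfRecord₁₃Ax F 2 (theta13OfThm1CCMWZBAx F 2 j (1 / 2) a₀ ε₀ ε₂₉ B₃ B₃' a₀ a₁ (fun _ _ => 0) (fun _ _ => 0)))) :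
    AbsBetaBoxAtThm1WitnessCCMGenGridGZBAxAt F :=
  fun j _c _c₀ _c₁ B₃ B₃' a₀ a₁ _hc _hc₀ _hc₁ _hB₃ _hB₃' ha₀ _ha₁ _h15 _h9 => by
    obtain ⟨γ₀, ε₂₉, β', hγ₀, hε', hall⟩ := h a₀ ha₀
    exact ⟨γ₀, a₀, ε₂₉, β', hγ₀, ha₀, hε', hall j a₀ B₃ B₃' a₁⟩

/-- **★ THE TOKEN-FREE CORE PAYS THE STRENGTHENED TEXT OF LOCATED-K0ε₀** `K0V23DefsAx.AbsBetaBoxAtThm1WitnessCCMGenGridGZBEps0AxAt F` as well (∃-output `ε₀ := a₀`; the letter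
`2·a₀ ≤ a₀·L²` holds since `11 < L`).  CONDITIONAL; nothing asserted; no value of `ε₀` chosen FOR anybody (§4: every label serves). [cite: Balaban1987RG1, Thm 1 p.259, (1.2) p.260, (0.21) p.256, §1 (1.20)–(1.22) p.264; Balaban1985Variational, Thm 1 (8)–(9) p.279; Balaban1988Convergent, (2.1) p.254, (2.5) p.255 (bookkeeping)] -/
theorem absBetaBoxGZBEps0At_of_tokenFreeZB
    (h : ∀ a₀ : ℝ, 0 < a₀ → ∃ γ₀ ε₂₉ β' : ℝ, 0 < γ₀ ∧ 0 < ε₂₉ ∧ ∀ (j : ℕ) (ε₀ B₃ B₃' a₁ : ℝ),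
      BetaLowerH (-β') γ₀ (betaOfRecord₁₃Ax F 2 (theta13OfThm1CCMWZBAx F 2 j (1 / 2) a₀ ε₀ ε₂₉ B₃ B₃' a₀ a₁ (fun _ _ => 0) (fun _ _ => 0))) ∧
      BetaUpperH β' γ₀ (betaOfRecord₁₃Ax F 2 (theta13OfThm1CCMWZBAx F 2 j (1 / 2) a₀ ε₀ ε₂₉ B₃ B₃' a₀ a₁ (fun _ _ => 0) (fun _ _ => 0)))) :
    AbsBetaBoxAtThm1WitnessCCMGenGridGZBEps0AxAt F :=
  fun j _c _c₀ _c₁ B₃ B₃' a₀ a₁ _hc _hc₀ _hc₁ _hB₃ _hB₃' ha₀ _ha₁ _h15 _h9 => by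
    obtain ⟨γ₀, ε₂₉, β', hγ₀, hε', hall⟩ := h a₀ ha₀
    exact ⟨γ₀, a₀, ε₂₉, β', hγ₀, ha₀, hε', eps0Letter_self F ha₀.le, hall j a₀ B₃ B₃' a₁⟩

end TokenFree

/-! ## §4  ★ V23 ⟹ the strengthened text of LOCATED-K0ε₀ by `ε₀`-relabelling; the window reader -/

section Eps0

variable (F : T4Family)

/-- **★ THE V23 3ᴬ′ᴮ TEXT IMPLIES THE STRENGTHENED TEXT** `…GZBEps0At F` at every family: at a door the V23 text gives a box at SOME label `ε₀`; by §1 it is the box at the label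
`ε₀ := a₀`, where the letter `K0N09Eps0LetterAt F a₀ a₀` holds.  With p803783's converse door `K0V23DefsAx.absBetaBoxGenGridGZBAxAt_of_eps0` the two texts are EQUIVALENT (next theorem).
CONDITIONAL on the V23 text; nothing asserted; a re-labelling licensed by `rfl`, NOT a numerics pin. [cite: Balaban1987RG1, Thm 1 p.259, (1.2) p.260, (1.20)–(1.22) p.264; Balaban1985Variational, Thm 1 (8),(9) p.279; Balaban1988Convergent, (2.1) p.254, (2.5) p.255 (bookkeeping)] -/
theorem absBetaBoxGZBEps0At_of_GZBAt (h : AbsBetaBoxAtThm1WitnessCCMGenGridGZBAxAt F) : AbsBetaBoxAtThm1WitnessCCMGenGridGZBEps0AxAt F :=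
  fun j c c₀ c₁ B₃ B₃' a₀ a₁ hc hc₀ hc₁ hB₃ hB₃' ha₀ ha₁ h15 h9 => by
    obtain ⟨γ₀, ε₀, ε₂₉, β', hγ₀, -, hε', hbox⟩ := h j c c₀ c₁ B₃ B₃' a₀ a₁ hc hc₀ hc₁ hB₃ hB₃' ha₀ ha₁ h15 h9
    refine ⟨γ₀, a₀, ε₂₉, β', hγ₀, ha₀, hε', eps0Letter_self F ha₀.le, ?_⟩
    exact (absBoxZBRegime_iff_letters F j j a₀ ε₀ a₀ ε₂₉ B₃ B₃ B₃' B₃' a₁ a₁ γ₀ β' (fun _ _ => 0) (fun _ _ => 0) (fun _ _ => 0) (fun _ _ => 0)).1 hbox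

/-- **★ THE TWO V23-CURRENCY TEXTS ARE EQUIVALENT at every family**: strengthened (LOCATED-K0ε₀) ⟺ V23 3ᴬ′ᴮ. [cite: Balaban1987RG1, Thm 1 p.259, (1.2) p.260, §1 p.264 (bookkeeping)] -/
theorem absBetaBoxGZBEps0At_iff_GZBAt : AbsBetaBoxAtThm1WitnessCCMGenGridGZBEps0AxAt F ↔ AbsBetaBoxAtThm1WitnessCCMGenGridGZBAxAt F :=
  ⟨absBetaBoxGenGridGZBAxAt_of_eps0 F, absBetaBoxGZBEps0At_of_GZBAt F⟩

/-- **Family form**: a K1 face's displayed `h3e : ∀ F, …GZBEps0At F` FOLLOWS from the V23 skeleton's stub `∀ F, …GZBAt F`.  CONDITIONAL. [cite: Balaban1987RG1, Thm 1 p.259, (1.2) p.260 (bookkeeping)] -/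
theorem forall_absBetaBoxGZBEps0At_of_forall_GZBAt (h3 : ∀ F : T4Family, AbsBetaBoxAtThm1WitnessCCMGenGridGZBAxAt F) :
    ∀ F : T4Family, AbsBetaBoxAtThm1WitnessCCMGenGridGZBEps0AxAt F :=
  fun F => absBetaBoxGZBEps0At_of_GZBAt F (h3 F)

/-- **★ THE WINDOW READER**: from the V23 text, at every door carrying the riders and the two ᴮ antecedents there is a label `ε₀` IN THE WINDOW `2·a₀∕L² ≤ ε₀ ≤ a₀` (namely `ε₀ = a₀`)
with `0 < ε₀` and the abs β-box of the print-regime Z3 member at that label — and (last conjunct-free form `forall_label_absBoxZB_of_GZBAt`) the same box at EVERY label.  CONDITIONAL.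
[cite: Balaban1987RG1, Thm 1 p.259, (1.2) p.260, (0.21) p.256, (1.20)–(1.22) p.264; Balaban1985Variational, Thm 1 (8),(9) p.279; Balaban1984PropagatorsII, (2.3) p.224 (bookkeeping)] -/
theorem exists_window_absBoxZB_of_GZBAt (h : AbsBetaBoxAtThm1WitnessCCMGenGridGZBAxAt F) (j c c₀ c₁ : ℕ) (B₃ B₃' a₀ a₁ : ℝ)
    (hc : c ≤ F.L ^ j) (hc₀ : c₀ ≤ j + 1) (hc₁ : c₁ ≤ j) (hB₃ : 2 * (F.L : ℝ) ^ 2 ≤ B₃) (hB₃' : 0 < B₃') (ha₀ : 0 < a₀) (ha₁ : 0 < a₁)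
    (h15 : VariationalThm1RegSepCoP7MGB F 2
      (fun ν M g K k _s => c ≤ ν.M₁ ∧ k + c₀ ≤ F.m + K ∧ F.L ^ c₁ ∣ M ∧
        ∀ i, 1 ≤ i → i ≤ k → dCubeSide (F.P K).L M (RkOfRecord (F.P K).L ν.r (g i)) i ∣ (F.P K).sitesPerDir 0) (lamDatum F) (dataSmall7LamTopOf F 2) B₃ a₀ a₁)
    (h9 : Gauge9RegSepTopStepGB F 2 (fun ν K Ω => suppDomOfRecord F ν K Ω) (F.L ^ j)
      (fun ν M g K k _s => c ≤ ν.M₁ ∧ k + c₀ ≤ F.m + K ∧ F.L ^ c₁ ∣ M ∧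
        ∀ i, 1 ≤ i → i ≤ k → dCubeSide (F.P K).L M (RkOfRecord (F.P K).L ν.r (g i)) i ∣ (F.P K).sitesPerDir 0) (lamDatum F) (dataSmall7LamTopOf F 2) B₃ B₃' a₀ a₁) :
    ∃ γ₀ ε₀ ε₂₉ β' : ℝ, 0 < γ₀ ∧ 0 < ε₀ ∧ 0 < ε₂₉ ∧ 2 * a₀ ≤ ε₀ * (F.L : ℝ) ^ 2 ∧ ε₀ ≤ a₀ ∧
      BetaLowerH (-β') γ₀ (betaOfRecord₁₃Ax F 2 (theta13OfThm1CCMWZBAx F 2 j (1 / 2) a₀ ε₀ ε₂₉ B₃ B₃' a₀ a₁ (fun _ _ => 0) (fun _ _ => 0))) ∧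
      BetaUpperH β' γ₀ (betaOfRecord₁₃Ax F 2 (theta13OfThm1CCMWZBAx F 2 j (1 / 2) a₀ ε₀ ε₂₉ B₃ B₃' a₀ a₁ (fun _ _ => 0) (fun _ _ => 0))) := by
  obtain ⟨γ₀, ε₀, ε₂₉, β', hγ₀, hε₀, hε', hlet, hbox⟩ := absBetaBoxGZBEps0At_of_GZBAt F h j c c₀ c₁ B₃ B₃' a₀ a₁ hc hc₀ hc₁ hB₃ hB₃' ha₀ ha₁ h15 h9
  refine ⟨γ₀, a₀, ε₂₉, β', hγ₀, ha₀, hε', eps0Letter_self F ha₀.le, le_rfl, ?_⟩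
  exact (absBoxZBRegime_iff_letters F j j a₀ ε₀ a₀ ε₂₉ B₃ B₃ B₃' B₃' a₁ a₁ γ₀ β' (fun _ _ => 0) (fun _ _ => 0) (fun _ _ => 0) (fun _ _ => 0)).1 hbox

/-- **The strongest reader**: from the V23 text, at every door the abs β-box of the print-regime Z3 member holds AT EVERY LABEL `ε₀′` (with the box's own `γ₀, ε₂₉, β′`); a consumer
needing a relation between `ε₀′` and `(a₀, L, B₃, …)` picks its own `ε₀′`.  CONDITIONAL. [cite: Balaban1987RG1, Thm 1 p.259, (1.2) p.260, (1.20)–(1.22) p.264; Balaban1985Variational, Thm 1 (8),(9) p.279 (bookkeeping)] -/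
theorem forall_label_absBoxZB_of_GZBAt (h : AbsBetaBoxAtThm1WitnessCCMGenGridGZBAxAt F) (j c c₀ c₁ : ℕ) (B₃ B₃' a₀ a₁ : ℝ)
    (hc : c ≤ F.L ^ j) (hc₀ : c₀ ≤ j + 1) (hc₁ : c₁ ≤ j) (hB₃ : 2 * (F.L : ℝ) ^ 2 ≤ B₃) (hB₃' : 0 < B₃') (ha₀ : 0 < a₀) (ha₁ : 0 < a₁)
    (h15 : VariationalThm1RegSepCoP7MGB F 2
      (fun ν M g K k _s => c ≤ ν.M₁ ∧ k + c₀ ≤ F.m + K ∧ F.L ^ c₁ ∣ M ∧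
        ∀ i, 1 ≤ i → i ≤ k → dCubeSide (F.P K).L M (RkOfRecord (F.P K).L ν.r (g i)) i ∣ (F.P K).sitesPerDir 0) (lamDatum F) (dataSmall7LamTopOf F 2) B₃ a₀ a₁)
    (h9 : Gauge9RegSepTopStepGB F 2 (fun ν K Ω => suppDomOfRecord F ν K Ω) (F.L ^ j)
      (fun ν M g K k _s => c ≤ ν.M₁ ∧ k + c₀ ≤ F.m + K ∧ F.L ^ c₁ ∣ M ∧
        ∀ i, 1 ≤ i → i ≤ k → dCubeSide (F.P K).L M (RkOfRecord (F.P K).L ν.r (g i)) i ∣ (F.P K).sitesPerDir 0) (lamDatum F) (dataSmall7LamTopOf F 2) B₃ B₃' a₀ a₁)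
    (ε₀' : ℝ) :
    ∃ γ₀ ε₂₉ β' : ℝ, 0 < γ₀ ∧ 0 < ε₂₉ ∧
      BetaLowerH (-β') γ₀ (betaOfRecord₁₃Ax F 2 (theta13OfThm1CCMWZBAx F 2 j (1 / 2) a₀ ε₀' ε₂₉ B₃ B₃' a₀ a₁ (fun _ _ => 0) (fun _ _ => 0))) ∧
      BetaUpperH β' γ₀ (betaOfRecord₁₃Ax F 2 (theta13OfThm1CCMWZBAx F 2 j (1 / 2) a₀ ε₀' ε₂₉ B₃ B₃' a₀ a₁ (fun _ _ => 0) (fun _ _ => 0))) := by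
  obtain ⟨γ₀, ε₀, ε₂₉, β', hγ₀, -, hε', hbox⟩ := h j c c₀ c₁ B₃ B₃' a₀ a₁ hc hc₀ hc₁ hB₃ hB₃' ha₀ ha₁ h15 h9
  exact ⟨γ₀, ε₂₉, β', hγ₀, hε',
    (absBoxZBRegime_iff_letters F j j a₀ ε₀ ε₀' ε₂₉ B₃ B₃ B₃' B₃' a₁ a₁ γ₀ β' (fun _ _ => 0) (fun _ _ => 0) (fun _ _ => 0) (fun _ _ => 0)).1 hbox⟩

end Eps0

/-! ## §5  ★★ K0ᴬ BY NAME under the re-centred texts (V24 candidates): stub 1ᴮ (PROVED) + the stub-2′ text + the token-free core ∕ the re-centred 3ᴬ′ᴮ text (V24 candidate) + the displayed Stage-2 seam -/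

section ByName

/-- **★★ K0ᴬ's BODY AT EVERY FAMILY from stub 1ᴮ PROVED (`K0Stub1BHolds.prop8StepCoPGridGBAt_holds_all`), the stub-2′ text `h2P` ([6] Prop. 6 as printed on print's class — the V23
skeleton fills it from `B8Prop6PrintedZdCubPGamma.prop6Printed_zdCubP_γ_holds_pos`), the re-centred 3ᴬ′ᴮ text (V24 candidate) `h3`, and the displayed Stage-2 seam `hseam`** (post-seam: `rw [UbgOfRecord₁₃CoP_succ_chi]`;
pre-seam NOT provable and NOT claimed) — through `…ZBLamPrintAx`'s door `K0AllTorusOfStepTokensGuardedZBLamAx.k0BodyAx_of_stub1B_of_2P_of_3B`.  The shape the V23 skeleton's `Record13SepCoPHInhabited_of h1 h3` has with `h1`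
DISCHARGED.  CONDITIONAL; K0ᴬ NOT closed; nothing of Bałaban asserted. [cite: Balaban1985Variational, Thm 1 (8)–(9) p.279, (7) p.278, Prop. 8 p.304; Balaban1985RegularSpaces, Prop. 6 p.99; Balaban1984PropagatorsII, (2.3) p.224; Balaban1988Convergent, Thm 1 p.262, (2.1) p.254, (2.12)–(2.13) pp.256–257; Balaban1987RG1, Thm 1 p.259, (0.1) p.251, §1 p.264] -/
theorem k0Body_of_absBetaBoxGZB_byName
    (hseam : ∀ (F : T4Family) (θ : Stage13Params F 2) (p : B12.RunParams) (n : ℕ) (s : SeqOfRecord F θ.ν θ.τ9.M (gOfRecord₁₃Ax F 2 θ p) p.K (n + 1)) (W : MSField (F.P p.K) (SU 2)),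
      UbgOfRecord₁₃CoPChi F 2 θ (chiβOfRecord₁₃Ax F 2 θ) p (n + 1) s W = UbgMSCoPOfRecordB F 2 θ.ν θ.τ9.M (gOfRecord₁₃Ax F 2 θ p) p.K (n + 1) s W)
    (h2P : ∀ F : T4Family, ∃ (ρ₀ : ℕ) (B₁ c₁ : ℝ), 1 ≤ ρ₀ ∧ 0 ≤ B₁ ∧ 0 < c₁ ∧
      (letI : CStarAlgebra (MatA 2) := {}; B8.Prop6Printed 4 (F.L : ℝ) B₁ c₁ (fun i : ZdIdx 4 F.L => zdCubP (MatA 2) F.L ρ₀ i)))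
    (h3 : ∀ F : T4Family, AbsBetaBoxAtThm1WitnessCCMGenGridGZBAxAt F) :
    ∀ F : T4Family, ∃ θ : Stage13HParams F 2, θ.Provisos₁₃SepCoPHAx F 2 ∧ (θ.ZhUnity F 2 ∧ θ.SlotsNondegenerate₁₃Ax F 2) ∧ θ.Admissible F 2 :=
  k0BodyAx_of_stub1B_of_2P_of_3B hseam prop8StepCoPGridGBAt_holds_all h2P h3

/-- **★★★ K0ᴬ's BODY AT EVERY FAMILY from stub 1ᴮ PROVED, the stub-2′ text, THE TOKEN-FREE CORE (ONE sign-free box of `β₁₃(F; εbg = εreg = a₀, ε₂₉)` per radius `a₀ > 0` — NODE O's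
bill, text-independent) and the displayed seam** (§3 then the previous theorem).  So on registration day, post-seam, a NODE O producer's `box : ∀ F a₀, 0 < a₀ → …` closes K0ᴬ by
`k0Body_of_tokenFreeZB_byName (fun _ _ _ _ _ _ => by rw [UbgOfRecord₁₃CoP_succ_chi]) <2′> box`.  CONDITIONAL; K0ᴬ NOT closed; nothing of Bałaban asserted. [cite: Balaban1985Variational, Thm 1 (8)–(9) p.279, Prop. 8 p.304; Balaban1985RegularSpaces, Prop. 6 p.99; Balaban1988Convergent, Thm 1 p.262, (2.1) p.254, (2.12)–(2.13) pp.256–257; Balaban1987RG1, Thm 1 p.259, §1 (1.20)–(1.22) p.264, (2.9) p.266, (0.1) p.251; Balaban1989LargeFieldII, p.355] -/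
theorem k0Body_of_tokenFreeZB_byName
    (hseam : ∀ (F : T4Family) (θ : Stage13Params F 2) (p : B12.RunParams) (n : ℕ) (s : SeqOfRecord F θ.ν θ.τ9.M (gOfRecord₁₃Ax F 2 θ p) p.K (n + 1)) (W : MSField (F.P p.K) (SU 2)),
      UbgOfRecord₁₃CoPChi F 2 θ (chiβOfRecord₁₃Ax F 2 θ) p (n + 1) s W = UbgMSCoPOfRecordB F 2 θ.ν θ.τ9.M (gOfRecord₁₃Ax F 2 θ p) p.K (n + 1) s W)
    (h2P : ∀ F : T4Family, ∃ (ρ₀ : ℕ) (B₁ c₁ : ℝ), 1 ≤ ρ₀ ∧ 0 ≤ B₁ ∧ 0 < c₁ ∧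
      (letI : CStarAlgebra (MatA 2) := {}; B8.Prop6Printed 4 (F.L : ℝ) B₁ c₁ (fun i : ZdIdx 4 F.L => zdCubP (MatA 2) F.L ρ₀ i)))
    (box : ∀ (F : T4Family) (a₀ : ℝ), 0 < a₀ → ∃ γ₀ ε₂₉ β' : ℝ, 0 < γ₀ ∧ 0 < ε₂₉ ∧ ∀ (j : ℕ) (ε₀ B₃ B₃' a₁ : ℝ),
      BetaLowerH (-β') γ₀ (betaOfRecord₁₃Ax F 2 (theta13OfThm1CCMWZBAx F 2 j (1 / 2) a₀ ε₀ ε₂₉ B₃ B₃' a₀ a₁ (fun _ _ => 0) (fun _ _ => 0))) ∧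
      BetaUpperH β' γ₀ (betaOfRecord₁₃Ax F 2 (theta13OfThm1CCMWZBAx F 2 j (1 / 2) a₀ ε₀ ε₂₉ B₃ B₃' a₀ a₁ (fun _ _ => 0) (fun _ _ => 0)))) :
    ∀ F : T4Family, ∃ θ : Stage13HParams F 2, θ.Provisos₁₃SepCoPHAx F 2 ∧ (θ.ZhUnity F 2 ∧ θ.SlotsNondegenerate₁₃Ax F 2) ∧ θ.Admissible F 2 :=
  k0Body_of_absBetaBoxGZB_byName hseam h2P fun F => absBetaBoxGZBAt_of_tokenFreeZB F (box F)

/-- **★★ THE CRUX DECL BY NAME** `Summit.QuantumFields.YangMills.Theses.BalabanUVNodes.Record13SepCoPHInhabitedAx` (K0ᴬ stmt-QuantumFields-27238; its body IS the `∀ F, ∃ θ, …` sentence,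
`Iff.rfl`) from stub 1ᴮ PROVED, the stub-2′ text, the re-centred 3ᴬ′ᴮ text (V24 candidate) and the displayed seam.  A HELPER (three displayed hypotheses), NOT a closer; K0ᴬ OPEN. [cite: Balaban1985Variational, Thm 1 (8)–(9) p.279, Prop. 8 p.304; Balaban1985RegularSpaces, Prop. 6 p.99; Balaban1988Convergent, Thm 1 p.262, (2.12)–(2.13) pp.256–257; Balaban1987RG1, Thm 1 p.259, (0.1) p.251] -/
theorem record13SepCoPHInhabitedAx_of_absBetaBoxGZB_byName
    (hseam : ∀ (F : T4Family) (θ : Stage13Params F 2) (p : B12.RunParams) (n : ℕ) (s : SeqOfRecord F θ.ν θ.τ9.M (gOfRecord₁₃Ax F 2 θ p) p.K (n + 1)) (W : MSField (F.P p.K) (SU 2)),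
      UbgOfRecord₁₃CoPChi F 2 θ (chiβOfRecord₁₃Ax F 2 θ) p (n + 1) s W = UbgMSCoPOfRecordB F 2 θ.ν θ.τ9.M (gOfRecord₁₃Ax F 2 θ p) p.K (n + 1) s W)
    (h2P : ∀ F : T4Family, ∃ (ρ₀ : ℕ) (B₁ c₁ : ℝ), 1 ≤ ρ₀ ∧ 0 ≤ B₁ ∧ 0 < c₁ ∧
      (letI : CStarAlgebra (MatA 2) := {}; B8.Prop6Printed 4 (F.L : ℝ) B₁ c₁ (fun i : ZdIdx 4 F.L => zdCubP (MatA 2) F.L ρ₀ i)))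
    (h3 : ∀ F : T4Family, AbsBetaBoxAtThm1WitnessCCMGenGridGZBAxAt F) :
    Summit.QuantumFields.YangMills.Theses.BalabanUVNodes.Record13SepCoPHInhabitedAx :=
  k0Body_of_absBetaBoxGZB_byName hseam h2P h3

/-- **★★★ THE CRUX DECL BY NAME from stub 1ᴮ PROVED, the stub-2′ text, THE TOKEN-FREE CORE and the displayed seam.**  A HELPER, NOT a closer; K0ᴬ OPEN; the core is NODE O's wall. [cite: Balaban1985Variational, Thm 1 (8)–(9) p.279, Prop. 8 p.304; Balaban1985RegularSpaces, Prop. 6 p.99; Balaban1988Convergent, Thm 1 p.262, (2.12)–(2.13) pp.256–257; Balaban1987RG1, Thm 1 p.259, §1 (1.20)–(1.22) p.264, (0.1) p.251; Balaban1989LargeFieldII, p.355] -/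
theorem record13SepCoPHInhabitedAx_of_tokenFreeZB_byName
    (hseam : ∀ (F : T4Family) (θ : Stage13Params F 2) (p : B12.RunParams) (n : ℕ) (s : SeqOfRecord F θ.ν θ.τ9.M (gOfRecord₁₃Ax F 2 θ p) p.K (n + 1)) (W : MSField (F.P p.K) (SU 2)),
      UbgOfRecord₁₃CoPChi F 2 θ (chiβOfRecord₁₃Ax F 2 θ) p (n + 1) s W = UbgMSCoPOfRecordB F 2 θ.ν θ.τ9.M (gOfRecord₁₃Ax F 2 θ p) p.K (n + 1) s W)
    (h2P : ∀ F : T4Family, ∃ (ρ₀ : ℕ) (B₁ c₁ : ℝ), 1 ≤ ρ₀ ∧ 0 ≤ B₁ ∧ 0 < c₁ ∧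
      (letI : CStarAlgebra (MatA 2) := {}; B8.Prop6Printed 4 (F.L : ℝ) B₁ c₁ (fun i : ZdIdx 4 F.L => zdCubP (MatA 2) F.L ρ₀ i)))
    (box : ∀ (F : T4Family) (a₀ : ℝ), 0 < a₀ → ∃ γ₀ ε₂₉ β' : ℝ, 0 < γ₀ ∧ 0 < ε₂₉ ∧ ∀ (j : ℕ) (ε₀ B₃ B₃' a₁ : ℝ),
      BetaLowerH (-β') γ₀ (betaOfRecord₁₃Ax F 2 (theta13OfThm1CCMWZBAx F 2 j (1 / 2) a₀ ε₀ ε₂₉ B₃ B₃' a₀ a₁ (fun _ _ => 0) (fun _ _ => 0))) ∧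
      BetaUpperH β' γ₀ (betaOfRecord₁₃Ax F 2 (theta13OfThm1CCMWZBAx F 2 j (1 / 2) a₀ ε₀ ε₂₉ B₃ B₃' a₀ a₁ (fun _ _ => 0) (fun _ _ => 0)))) :
    Summit.QuantumFields.YangMills.Theses.BalabanUVNodes.Record13SepCoPHInhabitedAx :=
  k0Body_of_tokenFreeZB_byName hseam h2P box

end ByName

end Summit.QuantumFields.YangMills.Theorems.K0V23Stub3SocketsAx

end
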